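import Literature.NumberTheory.EllipticCurves.Rank1Residual.X9NoEntry
import Summits.BirchSwinnertonDyer.Rank1Residual.GaloisImage.TorsionIsoImageObstruction
import Literature.NumberTheory.EllipticCurves.EmertonPollackWeston2006.MuAnTransferGoodOrdinary
import Literature.NumberTheory.EllipticCurves.CyclotomicIwasawaMainTheoremIrreducible
import Literature.NumberTheory.EllipticCurves.LeadingTermPPartRankLeOne
import Literature.NumberTheory.EllipticCurves.ModPReducibilityProofs
import HarnessLib

/-!
# Class X9: the DISCHARGE INTERFACE — leaf predicate ⟹ the hypotheses of the cited theorems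

Print-tier cell `bsd-print-x9` (D-0131 (2), key `x9`), typer seat ty2. Theorems only: no definition,
no new named fact (D-0014 / D-0026); every published input enters as an explicit binder
(`hBCS`, `hK`, `hGV`, `hEPW`, `hYZ`) whose `def … : Prop` already lives in `Literature/`. The file sits
Summits-side (it is plumbing about OUR class predicates, not a published statement) but declares its
API as dot-notation extensions of the Literature predicates `Rank1Residual.ClassX9` / `ClassX10`
(absolute names `Literature.NumberTheory.EllipticCurves.Rank1Residual.ClassX9.*`, the tree's
convention for dot-notation extensions living in another directory), so that a prover holding
`h : Rank1Residual.ClassX9 W p` writes `h.five_le`, `h.bcs112a hBCS …`, `h.gv14 hGV …`. From the leaf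
binder `hX9 : Summit.….Rank1Residual.ClassX9 W p` (Theorems/Rank1ResidualX9Defs) first take
`h := classX9_census_of_classX9 W p hX9` (Theorems/Rank1ResidualX9CMPartner).

The two partition leaves of the cell are stated over the census predicates of
`Rank1Residual/Predicates.lean`:

* **X9** — `ClassX9 W p := ¬cm ∧ GoodOrd W p ∧ 5 ≤ p ∧ Irr W p ∧ ¬Surj W p ∧ (r = 1 → ¬sst)`
  (leaf `Summit.….Rank1Residual.BSDpOnClassX9`, whose Summits-side `ClassX9` is bridged to this one
  by `classX9_census_of_classX9` / `classX9_of_classX9_census`);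
* **X10b** — `ClassX10 W p` (`p = 3`, `GoodOrd W 3`, `Irr W 3`, rank clause) together with
  `¬ Surj W 3` (leaf `Summit.….Rank1Residual.X10.BSDpOnClassX10b`).

A prover who closes a leaf BY NAME from a cited theorem must feed that theorem's binders from the
leaf predicate. This file is that plumbing for X9, in four groups (the X10b twin, at `p = 3`, is the
companion file `X10/LeafDischargeX10b.lean`).

1. **Projections** (`ClassX9.goodOrd`, `.good`, `.not_dvd_frobeniusTrace`, `.isOrdinaryAt`,
   `.five_le`, `.three_lt`, `.ne_two`, `.irr`, `.not_surj`, …): the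
   class-level hypotheses of every cited theorem, in each of the spellings the tree's facts use
   (`GoodOrd` / `HasGoodReductionAtPrime ∧ p ∤ a_p` / `IsOrdinaryAt`; `5 ≤ p` / `3 < p` / `p ≠ 2`).
2. **By-name specialisations** of the cited theorems to the class, leaving exactly the per-pair data
   (cyclotomic datum, newform, dual datum; partner curve and congruence) as binders:
   Burungale–Castella–Skinner 2025 Thm. 1.1.2 (a) (`ClassX9.bcs112a`), Kato 2004 Thm. 17.4 (1)(2)
   (`ClassX9.kato174`), Greenberg–Vatsal 2000 Prop. 3.7 — a tree THEOREM —
   (`ClassX9.padicLCoeff_norm_le_one`), Greenberg–Vatsal 2000 Thm. (1.4) (`ClassX9.gv14`),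
   Emerton–Pollack–Weston 2006 Thm. 1 (`ClassX9.epw1`).
3. **Congruence transport of the image** — surjectivity of `ρ̄_{E,p}` is an invariant of the
   `Γ_ℚ`-module `E[p]` (tree theorem
   `Summit.BirchSwinnertonDyer.Rank1Residual.GaloisImage.hasSurjectiveModNGaloisRep_iff_of_torsionIso`,
   `GaloisImage/TorsionIsoImageObstruction.lean`, cell b2b n1011), read on the leaf: a `p`-congruent
   partner of an X9 curve is NEVER surjective at `p` (`ClassX9.not_surj_of_torsionIso`) and is
   either CM or itself of class X9 (`ClassX9.partner_hasCM_or_classX9`). This is the kernel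
   form of the remark that the
   Greenberg–Vatsal / Emerton–Pollack–Weston transport cannot import `μ = 0` from a surjective-image
   curve: the partners available to X9 are CM curves (split-dihedral image) or other X9 curves.
4. **Dead hypotheses**, next to the ones already recorded in `X9SmallImage` / `X9NoEntry`
   ((im) = `BigIm`, (ram) = `Ram`, semistability): W. Zhang 2014 Thm. 1.4 hypothesis (3) is
   UNSATISFIABLE on X9 — `N_E` is never square-free there (Serre 1972 Prop. 21) while
   `Ram(ρ̄_{E,p})` is always empty (Serre Prop. 15 with Tate's parametrisation) —
   `ClassX9.zhang14_hyp3_dead`; and hypothesis (2) reduces on X9 to "no multiplicative prime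
   `ℓ ≡ ±1 (mod p)`" (`ClassX9.zhang14_hyp2_iff`).

Nothing here is a class theorem and nothing is asserted about any curve; X9 keeps its label.
Binder order in group 2 is always: published fact, class hypothesis, then per-pair data.

## References (hypotheses quoted from the tree's fact docstrings, which carry the page locators)

* [BurungaleCastellaSkinner2025] Thm. 1.1.2 (a) (arXiv:2405.00270v2 p. 2): `p > 3` good ordinary, (irr_ℚ).
* [Kato2004Asterisque] Thm. 17.4 (p. 273): (1)(2) for `f` good ordinary at `p`; (3) under (12.5.2).
* [GreenbergVatsal2000] Thm. (1.4) (§1): odd `p`, both curves good ordinary, `E₁[p] ≅ E₂[p]` irreducible;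
  Prop. (3.7): `L_p(E) ∈ Λ` for odd good ordinary `p` and `E[p]` irreducible.
* [EmertonPollackWeston2006] Thm. 1 (p. 2), §1 ("fix an odd prime `p`"), §2.6 (`p`-distinguished).
* [WZhang2014] Thm. 1.4 (p. 197) hypotheses (1)–(4); p. 194 (`Ram(ρ̄_{E,p})`).
* [Serre1972] §2.4 Prop. 15, §5.4 Prop. 21 i).
-/

noncomputable section

open scoped Classical MatrixGroups ModularForm

open CongruenceSubgroup WeierstrassCurve Field Literature.NumberTheory.EllipticCurves
  Literature.NumberTheory.EllipticCurves.ModularForms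

namespace Literature.NumberTheory.EllipticCurves.Rank1Residual

/-! ## 1. Class X9: projections of the leaf predicate -/

section X9

variable {W : WeierstrassCurve ℚ} [W.IsGloballyMinimal] {p : ℕ} [Fact p.Prime]

/-- X9 ⟹ `E` has no CM (Burungale–Castella–Skinner Cor. 1.3.1 "non-CM"; the class row). [folklore] -/
theorem ClassX9.not_hasCM (h : ClassX9 W p) : ¬ W.HasCM := h.1

/-- X9 ⟹ ord(p): good ordinary reduction at `p`, census spelling `GoodOrd`. [folklore] -/
theorem ClassX9.goodOrd (h : ClassX9 W p) : GoodOrd W p := h.2.1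

/-- X9 ⟹ good(p) (`W.HasGoodReductionAtPrime p`; the `hgood` binder of BCS Thm. 1.1.2 (a),
Greenberg–Vatsal Thm. (1.4), Emerton–Pollack–Weston Thm. 1). [folklore] -/
theorem ClassX9.good (h : ClassX9 W p) : Good W p := h.2.1.1

/-- X9 ⟹ `p ∤ a_p` (the `hord` binder of BCS Thm. 1.1.2 (a), GV Thm. (1.4), EPW Thm. 1). [folklore] -/
theorem ClassX9.not_dvd_frobeniusTrace (h : ClassX9 W p) : ¬ (p : ℤ) ∣ W.frobeniusTrace p := h.2.1.2

/-- X9 ⟹ `IsOrdinaryAt W p` — the spelling of the ordinarity binder of Kato's Thm. 17.4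
(`kato_divisibility`) and of Greenberg–Vatsal Prop. 3.7 (`padicLFunction_mem_integral`). [folklore] -/
theorem ClassX9.isOrdinaryAt (h : ClassX9 W p) : IsOrdinaryAt W p := (isOrdinaryAt_iff W p).mpr h.2.1

/-- X9 ⟹ `5 ≤ p` (the `hp` binder of BCS Thm. 1.1.2 (a), EPW Thm. 1, W. Zhang Thm. 1.4). [folklore] -/
theorem ClassX9.five_le (h : ClassX9 W p) : 5 ≤ p := h.2.2.1

/-- X9 ⟹ `3 < p` (the "`p > 3`" binder of BCS Cor. 1.3.1). [folklore] -/
theorem ClassX9.three_lt (h : ClassX9 W p) : 3 < p := by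
  have := h.five_le; omega

/-- X9 ⟹ `3 ≤ p` (the "`p ≥ 3`" binder of Yan–Zhu Thm. 4.9). [folklore] -/
theorem ClassX9.three_le (h : ClassX9 W p) : 3 ≤ p := by
  have := h.five_le; omega

/-- X9 ⟹ `2 < p`. [folklore] -/
theorem ClassX9.two_lt (h : ClassX9 W p) : 2 < p := by
  have := h.five_le; omega

/-- X9 ⟹ `p ≠ 2` (the "odd `p`" binder of Kato Thm. 17.4 as typed, GV Thm. (1.4) and Prop. 3.7,
Greenberg LNM 1716 Thm. 4.1 as typed). [folklore] -/
theorem ClassX9.ne_two (h : ClassX9 W p) : p ≠ 2 := by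
  have := h.five_le; omega

/-- X9 ⟹ `p ≠ 3` (X9 and X10b are disjoint rows). [folklore] -/
theorem ClassX9.ne_three (h : ClassX9 W p) : p ≠ 3 := by
  have := h.five_le; omega

/-- X9 ⟹ irr(p) (`W.HasIrreducibleModPGaloisRep p`; (irr_ℚ) of BCS, "irreducible" of GV / EPW /
Yan–Zhu). [folklore] -/
theorem ClassX9.irr (h : ClassX9 W p) : Irr W p := h.2.2.2.1

/-- X9 ⟹ ¬red(p): `p` is not an Eisenstein prime, so every theorem stated at a REDUCIBLE prime
(Greenberg–Vatsal Thm. 1.3, Castella–Grossi–Skinner 2025 Thm. D, Keller–Yin) is off the class. [folklore] -/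
theorem ClassX9.not_red (h : ClassX9 W p) : ¬ Red W p := fun hr => hr h.irr

/-- X9 ⟹ ¬surj(p) — the defining clause; it kills hypothesis (1) of W. Zhang 2014 Thm. 1.4 and the
surjectivity clause (3) of Kato Thm. 17.4 / (12.5.2). [folklore] -/
theorem ClassX9.not_surj (h : ClassX9 W p) : ¬ Surj W p := h.2.2.2.2.1

/-- X9 ⟹ ¬anom(p) (anomalous primes are reducible by definition). [folklore] -/
theorem ClassX9.not_anom (h : ClassX9 W p) : ¬ Anom W p := fun ha => ha.1 h.irr

/-- X9 ⟹ ¬add(p) (`p` is good). [folklore] -/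
theorem ClassX9.not_addv (h : ClassX9 W p) : ¬ Addv W p := fun ha => ha.1 h.good

/-- X9 ⟹ ¬mult(p) (good and multiplicative reduction exclude each other; Silverman AEC VII.5.1). [folklore] -/
theorem ClassX9.not_mult (h : ClassX9 W p) : ¬ Mult W p := fun hm =>
  WeierstrassCurve.HasMultiplicativeReduction.not_hasGoodReduction (R := ℤ_[p]) hm h.good

/-- X9 ⟹ not X10 (the prime of X10 is `3`). [folklore] -/
theorem ClassX9.not_classX10 (h : ClassX9 W p) : ¬ ClassX10 W p := fun h' => h.ne_three h'.1

/-- **Constructor**: the five census clauses give `ClassX9` (the rank clause is automatic,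
`classX9_iff`). [folklore] -/
theorem ClassX9.of_clauses [W.IsElliptic] (hcm : ¬ W.HasCM) (hord : GoodOrd W p) (hp : 5 ≤ p)
    (hirr : Irr W p) (hns : ¬ Surj W p) : ClassX9 W p :=
  (classX9_iff W p).mpr ⟨hcm, hord, hp, hirr, hns⟩

/-- X9 ⟹ `N_E` is not square-free in the spelling `W.IsSemistable ℤ` (the antecedent of W. Zhang
2014 Thm. 1.4 (3) "if `N` is not square-free"); from `ClassX9.not_semistable` (Serre Prop. 21).
[cite: Serre1972, §5.4 Prop. 21 i)] -/
theorem ClassX9.not_isSemistable_int [W.IsElliptic] (h : ClassX9 W p) : ¬ W.IsSemistable ℤ :=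
  fun hs => ClassX9.not_semistable W p h ((semistable_iff_isSemistable_int W).mpr hs)

/-! ## 2. Class X9: the cited theorems, specialised BY NAME -/

/-- **BCS 2025 Thm. 1.1.2 (a) on X9** (`burungale_castella_skinner_charIdeal_eq_padicLFunction`, binder
`hBCS`): at every X9 pair, for every cyclotomic datum `(κ, γ)`, newform `f` of `E` and dual datum
`D`, `X(E/ℚ_∞)` is `Λ`-torsion and `char_Λ X = (g)` with `ι g = p^k · L_p(f, α)` for some `k ∈ ℤ`
— the RATIONAL main conjecture; its four class-level binders `5 ≤ p`, good, `p ∤ a_p`, (irr_ℚ)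
are discharged from the leaf predicate. (Part (b), `k = 0`, needs (im), dead on X9:
`ClassX9.not_bigIm`.) [cite: BurungaleCastellaSkinner2025, Thm. 1.1.2 (a) (p. 2 of arXiv:2405.00270v2)] -/
theorem ClassX9.bcs112a [W.IsElliptic] (hBCS : burungale_castella_skinner_charIdeal_eq_padicLFunction)
    (h : ClassX9 W p) (κ : ZpExtension ℚ p) (γ : Field.absoluteGaloisGroup ℚ)
    {N : ℕ} [NeZero N] (f : CuspForm (Gamma0 N) 2)
    (hκ : κ.IsCyclotomic) (hγ : κ.IsTopGenerator γ) (hγ' : IsCyclotomicVariable p γ)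
    (hf : IsNewformOf W f) (D : W.SelmerDualData κ γ) :
    D.IsTorsion ∧ ∃ (g : IwasawaAlgebra p) (k : ℤ), D.charIdeal = Ideal.span {g} ∧
      iwasawaToPowerSeries p g =
        PowerSeries.C ((p : ℚ_[p]) ^ k) * padicLFunction f (unitRoot W p : ℚ_[p]) :=
  hBCS W p κ γ f h.five_le h.good h.not_dvd_frobeniusTrace h.irr hκ hγ hγ' hf D

/-- **Kato 2004 Thm. 17.4 (1)(2) on X9** (`kato_divisibility`, binder `hK`): `X(E/ℚ_∞)` is
`Λ`-torsion and `p^n · L_p(f, α) ∈ ι(char_Λ X)` for some `n ≥ 0` — the divisibility in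
`Λ[1/p]`, which carries NO image hypothesis; the binders `p ≠ 2` and `IsOrdinaryAt W p` are
discharged from the leaf predicate. Clause (3) (integral, under `ρ̄_{E,p^n}` onto for all `n`) is
unavailable on X9: its antecedent fails at `n = 1` (`ClassX9.not_surj`; Summits-side
`Summit.BirchSwinnertonDyer.Rank1Residual.ClassX9.not_forall_hasSurjectiveModNGaloisRep_pow`).
[cite: Kato2004Asterisque, Thm. 17.4 (1)(2) (p. 273)] -/
theorem ClassX9.kato174 [W.IsElliptic] {κ : ZpExtension ℚ p} {γ : Field.absoluteGaloisGroup ℚ}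
    {N : ℕ} [NeZero N] {f : CuspForm (Gamma0 N) 2}
    (hK : kato_divisibility W p (κ := κ) (γ := γ) (f := f)) (h : ClassX9 W p)
    (hκ : κ.IsCyclotomic) (hγ : κ.IsTopGenerator γ) (hγ' : IsCyclotomicVariable p γ)
    (hf : IsNewformOf W f) (D : W.SelmerDualData κ γ) :
    D.IsTorsion ∧ ∃ (n : ℕ) (g : IwasawaAlgebra p), g ∈ D.charIdeal ∧
      iwasawaToPowerSeries p g =
        PowerSeries.C ((p : ℚ_[p]) ^ n) * padicLFunction f (unitRoot W p : ℚ_[p]) :=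
  have hk := hK h.ne_two h.isOrdinaryAt hκ hγ hγ' hf D
  ⟨hk.1, hk.2.1⟩

/-- **Greenberg–Vatsal 2000 Prop. (3.7) on X9 — a tree THEOREM, no binder**
(`padicLFunction_mem_integral_holds`): at an X9 pair every coefficient of `L_p(f, α, T)` lies in
`ℤ_p` (`p` odd good ordinary, `E[p]` irreducible — all from the leaf predicate). Hence `μ(L_p) ≥ 0`
and the analytic `μ = 0` certificate is "one coefficient is a unit". [cite: GreenbergVatsal2000, Prop. (3.7)] -/
theorem ClassX9.padicLCoeff_norm_le_one [W.IsElliptic] (h : ClassX9 W p)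
    {N : ℕ} [NeZero N] {f : CuspForm (Gamma0 N) 2} (hf : IsNewformOf W f) (k : ℕ) :
    ‖padicLCoeff f (unitRoot W p : ℚ_[p]) k‖ ≤ 1 :=
  padicLFunction_mem_integral_holds h.ne_two h.isOrdinaryAt hf h.irr k

/-! ### Congruent partners of an X9 curve -/

/-- **A `p`-congruent partner of an X9 curve is not surjective at `p`** (the image is a congruence
invariant — tree theorem `GaloisImage.hasSurjectiveModNGaloisRep_of_torsionIso`). Consequently the
Greenberg–Vatsal / Emerton–Pollack–Weston transport to an X9 pair never starts from a
surjective-image curve: the partners are CM curves or X9 curves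
(`ClassX9.partner_hasCM_or_classX9`). [folklore] -/
theorem ClassX9.not_surj_of_torsionIso (h : ClassX9 W p) {A : WeierstrassCurve ℚ}
    (e : geomTorsion A (p : ℤ) ≃+ geomTorsion W (p : ℤ))
    (he : ∀ (σ : Field.absoluteGaloisGroup ℚ) (P : geomTorsion A (p : ℤ)), e (σ • P) = σ • e P) :
    ¬ Surj A p :=
  fun hA => h.not_surj
    (Summit.BirchSwinnertonDyer.Rank1Residual.GaloisImage.hasSurjectiveModNGaloisRep_of_torsionIso
      e he hA)

/-- A `p`-congruent partner of an X9 curve has irreducible `A[p]` (transport of (irr_ℚ) along the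
inverse isomorphism; `Rank1Residual.hasIrreducibleModPGaloisRep_of_torsionIso_symm`) — so the
partner-side irreducibility binder of GV Thm. (1.4) / EPW Thm. 1 is never an extra certificate. [folklore] -/
theorem ClassX9.irr_of_torsionIso (h : ClassX9 W p) {A : WeierstrassCurve ℚ}
    (e : geomTorsion A (p : ℤ) ≃+ geomTorsion W (p : ℤ))
    (he : ∀ (σ : Field.absoluteGaloisGroup ℚ) (P : geomTorsion A (p : ℤ)), e (σ • P) = σ • e P) :
    Irr A p :=
  hasIrreducibleModPGaloisRep_of_torsionIso_symm e he h.irr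

/-- **Partners of X9 curves are CM or X9.** A globally minimal `A/ℚ`, good ordinary at `p`, with
`A[p] ≅ E[p]` `Γ_ℚ`-equivariantly for an X9 pair `(E, p)`, either has CM or is itself an X9 pair at
`p` (non-CM, good ordinary, `p ≥ 5`, `A[p]` irreducible, `ρ̄_{A,p}` not onto). [folklore] -/
theorem ClassX9.partner_hasCM_or_classX9 (h : ClassX9 W p) {A : WeierstrassCurve ℚ} [A.IsElliptic]
    [A.IsGloballyMinimal] (hA : GoodOrd A p)
    (e : geomTorsion A (p : ℤ) ≃+ geomTorsion W (p : ℤ))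
    (he : ∀ (σ : Field.absoluteGaloisGroup ℚ) (P : geomTorsion A (p : ℤ)), e (σ • P) = σ • e P) :
    A.HasCM ∨ ClassX9 A p := by
  by_cases hcm : A.HasCM
  · exact Or.inl hcm
  · exact Or.inr (ClassX9.of_clauses hcm hA h.five_le (h.irr_of_torsionIso e he)
      (h.not_surj_of_torsionIso e he))

/-- **Greenberg–Vatsal 2000 Thm. (1.4) INTO an X9 pair** (`thm14_mainConjecture_transfer_of_torsionIso`,
binder `hGV`): for a globally minimal partner `A`, good ordinary at `p`, a `Γ_ℚ`-equivariant
`A[p] ≃ E[p]` (certificate C1) and Mazur's main conjecture WITH `μ = 0` for `A` at the cyclotomic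
datum (Néron normalisation; the partner-side input — Rubin 1991 for a CM partner, a trivial-arithmetic
certificate for a unit partner, …), Mazur's main conjecture with `μ = 0` holds at `(E, p)`. The
X9-side binders `p ≠ 2`, good, `p ∤ a_p`, irr — and the PARTNER's irreducibility — are discharged
here; what remains is `A`, `GoodOrd A p`, C1 and the partner's main conjecture.
[cite: GreenbergVatsal2000, Thm. (1.4) with Thm. (1.2) (arXiv:math/9906215 p. 5)] -/
theorem ClassX9.gv14 [W.IsElliptic]
    (hGV : GreenbergVatsal2000.thm14_mainConjecture_transfer_of_torsionIso) (h : ClassX9 W p)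
    {A : WeierstrassCurve ℚ} [A.IsElliptic] [A.IsGloballyMinimal] (hA : GoodOrd A p)
    (e : geomTorsion A (p : ℤ) ≃+ geomTorsion W (p : ℤ))
    (he : ∀ (σ : Field.absoluteGaloisGroup ℚ) (P : geomTorsion A (p : ℤ)), e (σ • P) = σ • e P)
    (κ : ZpExtension ℚ p) (γ : Field.absoluteGaloisGroup ℚ)
    (hκ : κ.IsCyclotomic) (hγ : κ.IsTopGenerator γ) (hγ' : IsCyclotomicVariable p γ)
    (hMCA : ∀ [NeZero (A.conductorNorm ℤ)] (fA : CuspForm (Gamma0 (A.conductorNorm ℤ)) 2),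
        IsNewformOf A fA → ∀ (ϖA : ℚ), (ϖA : ℝ) * A.realPeriodRat = plusPeriod fA →
      ∀ (DA : A.SelmerDualData κ γ), DA.IsTorsion ∧
        ∃ gA : IwasawaAlgebra p, DA.charIdeal = Ideal.span {gA} ∧
          GreenbergVatsal2000.HasUnitContent gA ∧
          iwasawaToPowerSeries p gA =
            PowerSeries.C (ϖA : ℚ_[p]) * padicLFunction fA (unitRoot A p : ℚ_[p]))
    [NeZero (W.conductorNorm ℤ)] (f : CuspForm (Gamma0 (W.conductorNorm ℤ)) 2)
    (hf : IsNewformOf W f) (ϖ : ℚ) (hϖ : (ϖ : ℝ) * W.realPeriodRat = plusPeriod f)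
    (D : W.SelmerDualData κ γ) :
    D.IsTorsion ∧ ∃ g : IwasawaAlgebra p, D.charIdeal = Ideal.span {g} ∧
      GreenbergVatsal2000.HasUnitContent g ∧
      iwasawaToPowerSeries p g = PowerSeries.C (ϖ : ℚ_[p]) * padicLFunction f (unitRoot W p : ℚ_[p]) :=
  hGV A W p h.ne_two hA.1 hA.2 h.good h.not_dvd_frobeniusTrace ⟨e, he⟩ (h.irr_of_torsionIso e he)
    h.irr κ γ hκ hγ hγ' hMCA f hf ϖ hϖ D

/-- **Emerton–Pollack–Weston 2006 Thm. 1 (`∗ = an`) INTO an X9 pair**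
(`thm1_muAn_transfer_of_torsionIso`, binder `hEPW`): for a globally minimal partner `A`, good
ordinary at `p`, a `Γ_ℚ`-equivariant `A[p] ≃ E[p]` (C1) and the analytic `μ = 0` certificate for `A`
(one `p`-adic unit coefficient of `ϖ_A · L_p(f_A, α_A)`, Néron normalisation), the analytic `μ = 0`
holds at `(E, p)`. X9-side binders `5 ≤ p`, good, `p ∤ a_p` and the partner's irreducibility are
discharged here. [cite: EmertonPollackWeston2006, Thm. 1 (arXiv:math/0404484 p. 2)] -/
theorem ClassX9.epw1 [W.IsElliptic]
    (hEPW : EmertonPollackWeston2006.thm1_muAn_transfer_of_torsionIso) (h : ClassX9 W p)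
    {A : WeierstrassCurve ℚ} [A.IsElliptic] [A.IsGloballyMinimal] (hA : GoodOrd A p)
    (e : geomTorsion A (p : ℤ) ≃+ geomTorsion W (p : ℤ))
    (he : ∀ (σ : Field.absoluteGaloisGroup ℚ) (P : geomTorsion A (p : ℤ)), e (σ • P) = σ • e P)
    (hμA : ∀ [NeZero (A.conductorNorm ℤ)] (fA : CuspForm (Gamma0 (A.conductorNorm ℤ)) 2),
        IsNewformOf A fA → ∀ (ϖA : ℚ), (ϖA : ℝ) * A.realPeriodRat = plusPeriod fA →
      ∃ n : ℕ, ‖PowerSeries.coeff n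
        (PowerSeries.C (ϖA : ℚ_[p]) * padicLFunction fA (unitRoot A p : ℚ_[p]))‖ = 1)
    [NeZero (W.conductorNorm ℤ)] (f : CuspForm (Gamma0 (W.conductorNorm ℤ)) 2)
    (hf : IsNewformOf W f) (ϖ : ℚ) (hϖ : (ϖ : ℝ) * W.realPeriodRat = plusPeriod f) :
    ∃ n : ℕ, ‖PowerSeries.coeff n
      (PowerSeries.C (ϖ : ℚ_[p]) * padicLFunction f (unitRoot W p : ℚ_[p]))‖ = 1 :=
  hEPW A W p h.five_le hA.1 hA.2 h.good h.not_dvd_frobeniusTrace ⟨e, he⟩ (h.irr_of_torsionIso e he)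
    hμA f hf ϖ hϖ

/-! ### W. Zhang 2014, Thm. 1.4: hypothesis (3) is unsatisfiable on X9, (2) is a congruence check -/

/-- **On X9, `Ram(ρ̄_{E,p}) = ∅` in W. Zhang's spelling**: no multiplicative prime `ℓ` has
`p ∤ v_ℓ(Δ_min)` — for `ℓ ≠ p` this is `ClassX9.not_ram` (Serre Prop. 15 + Tate), and `ℓ = p` is
not multiplicative since `p` is good. [cite: WZhang2014, p. 194 (definition of Ram) and Thm. 1.4 (3) (p. 197)] -/
theorem ClassX9.zhang14_ram_empty [W.IsElliptic] (h : ClassX9 W p) :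
    ¬ ∃ ℓ : ℕ, ∃ _ : Fact ℓ.Prime, W.HasMultiplicativeReductionAtPrime ℓ ∧
      ¬ p ∣ padicValInt ℓ W.minimalDiscriminantInt := by
  rintro ⟨ℓ, hℓ, hmult, hv⟩
  by_cases hℓp : ℓ = p
  · subst hℓp
    exact h.not_mult hmult
  · exact ClassX9.not_ram W p h ⟨ℓ, hℓ, hℓp, hmult, hv⟩

/-- **W. Zhang 2014 Thm. 1.4 hypothesis (3) is UNSATISFIABLE on X9.** Hypothesis (3) reads "if `N`
is not square-free, then `#Ram(ρ̄_{E,p}) ≥ 1` and …"; on X9 the antecedent holds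
(`ClassX9.not_isSemistable_int`: an X9 curve always has an additive prime) while `Ram(ρ̄_{E,p})` is
empty (`ClassX9.zhang14_ram_empty`). So the binder `h3` of
`WZhang2014_padicValRat_bsd_rank_one_ordinary` — and Zhang's Hypothesis ♠ wherever it carries this
clause — cannot be supplied at any X9 pair, independently of the (also dead) surjectivity
hypothesis (1). [cite: WZhang2014, Thm. 1.4 (3) (p. 197)] [cite: Serre1972, §2.4 Prop. 15 and §5.4 Prop. 21 i)] -/
theorem ClassX9.zhang14_hyp3_dead [W.IsElliptic] (h : ClassX9 W p) :
    ¬ (¬ W.IsSemistable ℤ →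
      (∃ ℓ : ℕ, ∃ _ : Fact ℓ.Prime, W.HasMultiplicativeReductionAtPrime ℓ ∧
          ¬ p ∣ padicValInt ℓ W.minimalDiscriminantInt) ∧
        (Set.ncard {ℓ : ℕ | ∃ _ : Fact ℓ.Prime, W.HasMultiplicativeReductionAtPrime ℓ ∧
            ¬ p ∣ padicValInt ℓ W.minimalDiscriminantInt} = 1 →
          Even (Set.ncard {ℓ : ℕ | ∃ _ : Fact ℓ.Prime, W.HasMultiplicativeReductionAtPrime ℓ}))) :=
  fun h3 => h.zhang14_ram_empty (h3 h.not_isSemistable_int).1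

/-- **W. Zhang 2014 Thm. 1.4 hypothesis (2) on X9 is a congruence check on the multiplicative
primes**: since `ρ̄_{E,p}` is unramified at EVERY multiplicative `ℓ` on X9, "(2) if `ℓ ≡ ±1 mod p`
and `ℓ ∥ N` then `ρ̄_{E,p}` is ramified at `ℓ`" (the binder `h2` of
`WZhang2014_padicValRat_bsd_rank_one_ordinary`, verbatim) holds iff NO multiplicative prime of `E`
is `≡ ±1 (mod p)`. [cite: WZhang2014, Thm. 1.4 (2) (p. 197)] -/
theorem ClassX9.zhang14_hyp2_iff [W.IsElliptic] (h : ClassX9 W p) :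
    (∀ (ℓ : ℕ) [Fact ℓ.Prime], W.HasMultiplicativeReductionAtPrime ℓ →
      (p ∣ ℓ - 1 ∨ p ∣ ℓ + 1) → ¬ p ∣ padicValInt ℓ W.minimalDiscriminantInt) ↔
    (∀ (ℓ : ℕ) [Fact ℓ.Prime], W.HasMultiplicativeReductionAtPrime ℓ → ¬ (p ∣ ℓ - 1 ∨ p ∣ ℓ + 1)) := by
  constructor
  · intro H ℓ hℓ hmult hcong
    exact h.zhang14_ram_empty ⟨ℓ, hℓ, hmult, H ℓ hmult hcong⟩
  · intro H ℓ hℓ hmult hcong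
    exact absurd hcong (H ℓ hmult)

/-! ### Summary of the discharge for X9 (audit aid) -/

/-- **X9 discharge ledger.** At an X9 pair: the class-level binders that the cited theorems share are
available (non-CM, `5 ≤ p`, good, `p ∤ a_p`, irreducible) and the image-type binders are refuted
(¬surj, ¬(im), ¬(ram), ¬semistable). One conjunction for the referee's hypothesis-by-hypothesis audit;
each conjunct is a named theorem of this file or of `X9SmallImage` / `X9NoEntry`. [folklore] -/
theorem ClassX9.discharge_summary [W.IsElliptic] (h : ClassX9 W p) :
    (¬ W.HasCM ∧ 5 ≤ p ∧ W.HasGoodReductionAtPrime p ∧ ¬ (p : ℤ) ∣ W.frobeniusTrace p ∧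
        IsOrdinaryAt W p ∧ W.HasIrreducibleModPGaloisRep p) ∧
      (¬ Surj W p ∧ ¬ BigIm W p ∧ ¬ Ram W p ∧ ¬ Semistable W ∧ ¬ W.IsSemistable ℤ) :=
  ⟨⟨h.not_hasCM, h.five_le, h.good, h.not_dvd_frobeniusTrace, h.isOrdinaryAt, h.irr⟩,
    ⟨h.not_surj, ClassX9.not_bigIm W p h, ClassX9.not_ram W p h, ClassX9.not_semistable W p h,
      h.not_isSemistable_int⟩⟩

end X9

end Literature.NumberTheory.EllipticCurves.Rank1Residual
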